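import Summits.AtomisticToContinuum.Crystallization.Theorems.GscTwinLoopSurgeryGscHingeGlueLimit

/-!
# Route `GscTwinLoopSurgery`, support item `GscHingeGlue` (stmt-AtomisticToContinuum-14087): one periodic pattern

**Lemma C of the glue** (Step 3 of the item's sketch). Suppose that for every scale `(R, ε)`
a positive density of particles of the finite configurations `x N` is, for all large `N`, good
for SOME hcp pattern `hcpStacking a h` with `(a, h)` in the compact box `B′` (depending on the
particle). Then ONE parameter `(a, h) ∈ B′` works for every scale, frequently in `N`
(`exists_params_of_cover`): otherwise every point of `B′` has a bad scale; since goodness is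
monotone in the scale and stable under small changes of `(a, h)` (`good_of_good_of_params`,
from `dist_sub_sub_le_of_params`), the bad scales of finitely many points covering `B′` combine
into one scale at which the density bound fails. All `[folklore]`; nothing here closes an item.
-/

noncomputable section

open scoped BigOperators Topology
open Filter Set Metric

namespace Summit.AtomisticToContinuum.Crystallization.Theorems.GscHingeGlue

open Literature.MathematicalPhysics.StatisticalMechanics

/-! ## Goodness of a particle: monotonicity and parameter stability -/

section Good

variable {N : ℕ} (x : Fin N → EuclideanSpace ℝ (Fin 3)) (i : Fin N)

/-- Goodness is monotone in the scale: a larger radius and a smaller tolerance give the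
stronger property. [folklore] -/
theorem good_mono {Q : Set (EuclideanSpace ℝ (Fin 3))} {R R' ε ε' : ℝ} (hR : R' ≤ R) (hε : ε ≤ ε')
    (h : ∃ A : EuclideanSpace ℝ (Fin 3) →ₗᵢ[ℝ] EuclideanSpace ℝ (Fin 3), ∃ q ∈ Q,
      (∀ s ∈ Q, dist s q ≤ R → ∃ j, dist (x j) (x i + A (s - q)) ≤ ε) ∧
      (∀ j, dist (x j) (x i) ≤ R → ∃ s ∈ Q, dist (x j) (x i + A (s - q)) ≤ ε)) :
    ∃ A : EuclideanSpace ℝ (Fin 3) →ₗᵢ[ℝ] EuclideanSpace ℝ (Fin 3), ∃ q ∈ Q,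
      (∀ s ∈ Q, dist s q ≤ R' → ∃ j, dist (x j) (x i + A (s - q)) ≤ ε') ∧
      (∀ j, dist (x j) (x i) ≤ R' → ∃ s ∈ Q, dist (x j) (x i + A (s - q)) ≤ ε') := by
  obtain ⟨A, q, hq, h1, h2⟩ := h
  refine ⟨A, q, hq, fun s hs hsq => ?_, fun j hj => ?_⟩
  · obtain ⟨j, hj⟩ := h1 s hs (hsq.trans hR)
    exact ⟨j, hj.trans hε⟩
  · obtain ⟨s, hs, hjs⟩ := h2 j (hj.trans hR)
    exact ⟨s, hs, hjs.trans hε⟩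

/-- **Goodness is stable under small changes of the parameters.** If particle `i` is good for
`hcpStacking a h` at scale `(R + 1, ε/2)` and `|a - a'|, |h - h'| ≤ η` with
`2η (R + 1 + ε) ≤ min (ε/2) 1` (all parameters `≥ 1/2`), then it is good for `hcpStacking a' h'` at
scale `(R, ε)`: corresponding sites of the two stackings, seen from corresponding base points,
differ by at most `2η` times their distance (`dist_sub_sub_le_of_params`). [folklore] -/
theorem good_of_good_of_params {a h a' h' η R ε : ℝ} (ha : 1 / 2 ≤ a) (hh : 1 / 2 ≤ h)
    (ha' : 1 / 2 ≤ a') (hh' : 1 / 2 ≤ h') (haa : |a - a'| ≤ η) (hhh : |h - h'| ≤ η)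
    (hε : 0 ≤ ε) (hη1 : 2 * η * (R + 1 + ε) ≤ ε / 2) (hη2 : 2 * η * (R + 1 + ε) ≤ 1)
    (hgood : ∃ A : EuclideanSpace ℝ (Fin 3) →ₗᵢ[ℝ] EuclideanSpace ℝ (Fin 3), ∃ q ∈ hcpStacking a h,
      (∀ s ∈ hcpStacking a h, dist s q ≤ R + 1 → ∃ j, dist (x j) (x i + A (s - q)) ≤ ε / 2) ∧
      (∀ j, dist (x j) (x i) ≤ R + 1 →
        ∃ s ∈ hcpStacking a h, dist (x j) (x i + A (s - q)) ≤ ε / 2)) :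
    ∃ A : EuclideanSpace ℝ (Fin 3) →ₗᵢ[ℝ] EuclideanSpace ℝ (Fin 3), ∃ q ∈ hcpStacking a' h',
      (∀ s ∈ hcpStacking a' h', dist s q ≤ R → ∃ j, dist (x j) (x i + A (s - q)) ≤ ε) ∧
      (∀ j, dist (x j) (x i) ≤ R → ∃ s ∈ hcpStacking a' h', dist (x j) (x i + A (s - q)) ≤ ε) := by
  obtain ⟨A, q, hq, h1, h2⟩ := hgood
  obtain ⟨k₀, i₀, j₀, rfl⟩ := hq
  have hη : 0 ≤ η := (abs_nonneg _).trans haa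
  have haa' : |a' - a| ≤ η := by rwa [abs_sub_comm]
  have hhh' : |h' - h| ≤ η := by rwa [abs_sub_comm]
  have hηR1 : 2 * η * R ≤ 1 := by nlinarith [mul_nonneg hη hε]
  have hηR2 : 2 * η * R ≤ ε / 2 := by nlinarith [mul_nonneg hη hε]
  refine ⟨A, barlowPos a' h' alternatingHagg k₀ i₀ j₀, barlowPos_mem k₀ i₀ j₀, ?_, fun j hj => ?_⟩
  · intro s' hs' hs'q
    obtain ⟨k, i', j', rfl⟩ := hs'
    -- the corresponding site of `hcpStacking a h`
    have hpert := dist_sub_sub_le_of_params ha' hh' haa' hhh' alternatingHagg k i' j' k₀ i₀ j₀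
    have hd : dist (barlowPos a' h' alternatingHagg k i' j' - barlowPos a' h' alternatingHagg k₀ i₀ j₀)
        (barlowPos a h alternatingHagg k i' j' - barlowPos a h alternatingHagg k₀ i₀ j₀) ≤
        2 * η * R := hpert.trans (by nlinarith)
    have hsq : dist (barlowPos a h alternatingHagg k i' j') (barlowPos a h alternatingHagg k₀ i₀ j₀) ≤
        R + 1 := by
      have := dist_triangle (barlowPos a h alternatingHagg k i' j' - barlowPos a h alternatingHagg k₀ i₀ j₀)
        (barlowPos a' h' alternatingHagg k i' j' - barlowPos a' h' alternatingHagg k₀ i₀ j₀) 0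
      simp only [dist_zero_right, ← dist_eq_norm] at this
      rw [dist_comm] at hd
      linarith
    obtain ⟨j, hj⟩ := h1 _ (barlowPos_mem k i' j') hsq
    refine ⟨j, ?_⟩
    have e : dist (x i + A (barlowPos a h alternatingHagg k i' j' - barlowPos a h alternatingHagg k₀ i₀ j₀))
        (x i + A (barlowPos a' h' alternatingHagg k i' j' - barlowPos a' h' alternatingHagg k₀ i₀ j₀)) ≤
        2 * η * R := by
      rw [dist_add_left, A.dist_map, dist_comm]
      exact hd
    calc _ ≤ dist (x j) (x i + A (barlowPos a h alternatingHagg k i' j' -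
          barlowPos a h alternatingHagg k₀ i₀ j₀)) + dist (x i + A (barlowPos a h alternatingHagg k i' j' -
          barlowPos a h alternatingHagg k₀ i₀ j₀)) (x i + A (barlowPos a' h' alternatingHagg k i' j' -
          barlowPos a' h' alternatingHagg k₀ i₀ j₀)) := dist_triangle _ _ _
      _ ≤ ε / 2 + 2 * η * R := add_le_add hj e
      _ ≤ ε := by linarith
  · obtain ⟨s, hs, hjs⟩ := h2 j (by linarith)
    obtain ⟨k, i', j', rfl⟩ := hs
    refine ⟨barlowPos a' h' alternatingHagg k i' j', barlowPos_mem k i' j', ?_⟩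
    have hsq : dist (barlowPos a h alternatingHagg k i' j') (barlowPos a h alternatingHagg k₀ i₀ j₀) ≤
        R + 1 + ε := by
      have e1 : dist (barlowPos a h alternatingHagg k i' j') (barlowPos a h alternatingHagg k₀ i₀ j₀) =
          dist (x i + A (barlowPos a h alternatingHagg k i' j' - barlowPos a h alternatingHagg k₀ i₀ j₀))
            (x i) := by
        rw [dist_eq_norm, dist_eq_norm, add_sub_cancel_left, A.norm_map]
      rw [e1]
      calc _ ≤ dist (x i + A (barlowPos a h alternatingHagg k i' j' - barlowPos a h alternatingHagg k₀ i₀ j₀))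
            (x j) + dist (x j) (x i) := dist_triangle _ _ _
        _ ≤ ε / 2 + R := by rw [dist_comm]; exact add_le_add hjs hj
        _ ≤ R + 1 + ε := by linarith
    have hpert := dist_sub_sub_le_of_params ha hh haa hhh alternatingHagg k i' j' k₀ i₀ j₀
    have hd : dist (barlowPos a h alternatingHagg k i' j' - barlowPos a h alternatingHagg k₀ i₀ j₀)
        (barlowPos a' h' alternatingHagg k i' j' - barlowPos a' h' alternatingHagg k₀ i₀ j₀) ≤
        2 * η * (R + 1 + ε) := hpert.trans (by nlinarith)
    have e : dist (x i + A (barlowPos a h alternatingHagg k i' j' - barlowPos a h alternatingHagg k₀ i₀ j₀))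
        (x i + A (barlowPos a' h' alternatingHagg k i' j' - barlowPos a' h' alternatingHagg k₀ i₀ j₀)) ≤
        2 * η * (R + 1 + ε) := by
      rw [dist_add_left, A.dist_map]
      exact hd
    calc _ ≤ dist (x j) (x i + A (barlowPos a h alternatingHagg k i' j' -
          barlowPos a h alternatingHagg k₀ i₀ j₀)) + dist (x i + A (barlowPos a h alternatingHagg k i' j' -
          barlowPos a h alternatingHagg k₀ i₀ j₀)) (x i + A (barlowPos a' h' alternatingHagg k i' j' -
          barlowPos a' h' alternatingHagg k₀ i₀ j₀)) := dist_triangle _ _ _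
      _ ≤ ε / 2 + 2 * η * (R + 1 + ε) := add_le_add hjs e
      _ ≤ ε := by linarith

end Good

/-! ## Lemma C -/

/-- **Lemma C (one pattern for all scales).** If at every scale `(R, ε)` a positive density of
particles is, for all large `N`, good for some `hcpStacking a h` with `(a, h) ∈ B′`, then some
fixed `(a, h) ∈ B′` has, at every scale, a positive density of good particles for infinitely
many `N`. (Compactness of `B′`: cover it by finitely many parameter balls on which goodness at
the bad scale of the centre is implied by goodness at one common finer scale.) [folklore] -/
theorem exists_params_of_cover (x : (N : ℕ) → Fin N → EuclideanSpace ℝ (Fin 3))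
    (hgood : ∀ R ε : ℝ, 0 < R → 0 < ε → ∃ ρ : ℝ, 0 < ρ ∧ ∀ᶠ N : ℕ in atTop,
      ρ * (N : ℝ) ≤ (Nat.card {i : Fin N // ∃ a h : ℝ,
        (191 / 200 ≤ a ∧ a ≤ 197 / 200 ∧ 81 / 100 * a ≤ h ∧ h ≤ 329 / 400 * a) ∧
        ∃ A : EuclideanSpace ℝ (Fin 3) →ₗᵢ[ℝ] EuclideanSpace ℝ (Fin 3), ∃ q ∈ hcpStacking a h,
          (∀ s ∈ hcpStacking a h, dist s q ≤ R → ∃ j, dist (x N j) (x N i + A (s - q)) ≤ ε) ∧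
          (∀ j, dist (x N j) (x N i) ≤ R →
            ∃ s ∈ hcpStacking a h, dist (x N j) (x N i + A (s - q)) ≤ ε)} : ℝ)) :
    ∃ a h : ℝ, (191 / 200 ≤ a ∧ a ≤ 197 / 200 ∧ 81 / 100 * a ≤ h ∧ h ≤ 329 / 400 * a) ∧
      ∀ R ε : ℝ, 0 < R → 0 < ε → ∃ ρ : ℝ, 0 < ρ ∧ ∃ᶠ N : ℕ in atTop,
        ρ * (N : ℝ) ≤ (Nat.card {i : Fin N //
          ∃ A : EuclideanSpace ℝ (Fin 3) →ₗᵢ[ℝ] EuclideanSpace ℝ (Fin 3), ∃ q ∈ hcpStacking a h,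
            (∀ s ∈ hcpStacking a h, dist s q ≤ R → ∃ j, dist (x N j) (x N i + A (s - q)) ≤ ε) ∧
            (∀ j, dist (x N j) (x N i) ≤ R →
              ∃ s ∈ hcpStacking a h, dist (x N j) (x N i + A (s - q)) ≤ ε)} : ℝ) := by
  classical
  -- the goodness predicate and the box
  set Good : ℝ → ℝ → ℝ → ℝ → (N : ℕ) → Fin N → Prop := fun a h R ε N i =>
    ∃ A : EuclideanSpace ℝ (Fin 3) →ₗᵢ[ℝ] EuclideanSpace ℝ (Fin 3), ∃ q ∈ hcpStacking a h,
      (∀ s ∈ hcpStacking a h, dist s q ≤ R → ∃ j, dist (x N j) (x N i + A (s - q)) ≤ ε) ∧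
      (∀ j, dist (x N j) (x N i) ≤ R → ∃ s ∈ hcpStacking a h, dist (x N j) (x N i + A (s - q)) ≤ ε)
    with hGood
  set K : Set (ℝ × ℝ) := {p : ℝ × ℝ | 191 / 200 ≤ p.1 ∧ p.1 ≤ 197 / 200 ∧ 81 / 100 * p.1 ≤ p.2 ∧
      p.2 ≤ 329 / 400 * p.1} with hK
  by_contra H
  -- every point of the box has a bad scale
  have H1 : ∀ pt : ℝ × ℝ, ∃ R ε : ℝ, 0 < R ∧ 0 < ε ∧ (pt ∈ K → ∀ ρ : ℝ, 0 < ρ →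
      ∀ᶠ N : ℕ in atTop, (Nat.card {i : Fin N // Good pt.1 pt.2 R ε N i} : ℝ) < ρ * N) := by
    intro pt
    by_cases hpt : pt ∈ K
    · by_contra H2
      apply H
      refine ⟨pt.1, pt.2, hpt, fun R ε hR hε => ?_⟩
      by_contra H3
      apply H2
      refine ⟨R, ε, hR, hε, fun _ ρ hρ => ?_⟩
      have H4 : ¬ ∃ᶠ N : ℕ in atTop,
          ρ * (N : ℝ) ≤ (Nat.card {i : Fin N // Good pt.1 pt.2 R ε N i} : ℝ) :=
        fun h4 => H3 ⟨ρ, hρ, h4⟩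
      simpa only [not_frequently, not_le] using H4
    · exact ⟨1, 1, one_pos, one_pos, fun h => absurd h hpt⟩
  choose Rf εf hRf hεf hbad using H1
  -- the neighbourhoods on which goodness at the bad scale of the centre is inherited
  set η : ℝ × ℝ → ℝ := fun pt => min (εf pt / (4 * (Rf pt + 1 + εf pt))) (1 / (2 * (Rf pt + 1 + εf pt)))
    with hη
  have hηpos : ∀ pt, 0 < η pt := fun pt => by
    have := hRf pt
    have := hεf pt
    exact lt_min (by positivity) (by positivity)
  have hη1 : ∀ pt, 2 * η pt * (Rf pt + 1 + εf pt) ≤ εf pt / 2 := fun pt => by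
    have h1 : η pt ≤ εf pt / (4 * (Rf pt + 1 + εf pt)) := min_le_left _ _
    have h2 : 0 < Rf pt + 1 + εf pt := by linarith [hRf pt, hεf pt]
    calc 2 * η pt * (Rf pt + 1 + εf pt) ≤ 2 * (εf pt / (4 * (Rf pt + 1 + εf pt))) * (Rf pt + 1 + εf pt) := by
          gcongr
      _ = εf pt / 2 := by field_simp; ring
  have hη2 : ∀ pt, 2 * η pt * (Rf pt + 1 + εf pt) ≤ 1 := fun pt => by
    have h1 : η pt ≤ 1 / (2 * (Rf pt + 1 + εf pt)) := min_le_right _ _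
    have h2 : 0 < Rf pt + 1 + εf pt := by linarith [hRf pt, hεf pt]
    calc 2 * η pt * (Rf pt + 1 + εf pt) ≤ 2 * (1 / (2 * (Rf pt + 1 + εf pt))) * (Rf pt + 1 + εf pt) := by
          gcongr
      _ = 1 := by field_simp
  obtain ⟨T, hTK, hcover⟩ := isCompact_paramBox.elim_nhds_subcover (fun pt => ball pt (η pt))
    fun pt _ => ball_mem_nhds pt (hηpos pt)
  -- the box is non-empty, so is `T`
  have hK0 : ((97 / 100 : ℝ), (79 / 100 : ℝ)) ∈ K := by rw [hK]; norm_num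
  have hTne : T.Nonempty := by
    by_contra hT
    rw [Finset.not_nonempty_iff_eq_empty] at hT
    have := hcover hK0
    simp [hT] at this
  -- the common finer scale
  set Rs : ℝ := T.sup' hTne Rf + 1 with hRs
  set εs : ℝ := T.inf' hTne εf / 2 with hεs
  have hRs_ge : ∀ pt ∈ T, Rf pt + 1 ≤ Rs := fun pt hpt => by
    have := Finset.le_sup' Rf hpt
    linarith
  have hεs_le : ∀ pt ∈ T, εs ≤ εf pt / 2 := fun pt hpt => by
    have := Finset.inf'_le εf hpt
    rw [hεs]; linarith
  have hεs_pos : 0 < εs := by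
    rw [hεs]
    have : 0 < T.inf' hTne εf := (Finset.lt_inf'_iff hTne).2 fun pt _ => hεf pt
    linarith
  have hRs_pos : 0 < Rs := by
    obtain ⟨pt, hpt⟩ := hTne
    linarith [hRs_ge pt hpt, hRf pt]
  obtain ⟨ρ, hρ, hev⟩ := hgood Rs εs hRs_pos hεs_pos
  have hρT : 0 < ρ / T.card := div_pos hρ (by exact_mod_cast hTne.card_pos)
  have hbadT : ∀ pt ∈ T, ∀ᶠ N : ℕ in atTop,
      (Nat.card {i : Fin N // Good pt.1 pt.2 (Rf pt) (εf pt) N i} : ℝ) < ρ / T.card * N :=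
    fun pt hpt => hbad pt (hTK pt hpt) _ hρT
  obtain ⟨N, hN1, hN2⟩ := (hev.and ((Filter.eventually_all_finset T).2 hbadT)).exists
  -- count: good particles at the finer scale are good for some centre at its bad scale
  have hsub : (Finset.univ.filter fun i : Fin N => ∃ a h : ℝ,
      (191 / 200 ≤ a ∧ a ≤ 197 / 200 ∧ 81 / 100 * a ≤ h ∧ h ≤ 329 / 400 * a) ∧ Good a h Rs εs N i) ⊆
      T.biUnion fun pt => Finset.univ.filter fun i : Fin N => Good pt.1 pt.2 (Rf pt) (εf pt) N i := by
    intro i hi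
    simp only [Finset.mem_filter, Finset.mem_univ, true_and] at hi
    obtain ⟨a, h, hab, hgi⟩ := hi
    have habK : (a, h) ∈ K := hab
    obtain ⟨pt, hpt, hball⟩ : ∃ pt ∈ T, (a, h) ∈ ball pt (η pt) := by
      simpa only [mem_iUnion, exists_prop] using hcover habK
    simp only [Finset.mem_biUnion, Finset.mem_filter, Finset.mem_univ, true_and]
    refine ⟨pt, hpt, ?_⟩
    have hptK := hTK pt hpt
    simp only [mem_setOf_eq] at hptK
    rw [mem_ball, Prod.dist_eq, max_lt_iff, Real.dist_eq, Real.dist_eq] at hball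
    have hgi' : Good a h (Rf pt + 1) (εf pt / 2) N i := by
      simp only [hGood] at hgi ⊢
      exact good_mono (x N) i (hRs_ge pt hpt) (hεs_le pt hpt) hgi
    simp only [hGood] at hgi' ⊢
    exact good_of_good_of_params (x N) i (by linarith [hab.1]) (by nlinarith [hab.1, hab.2.2.1])
      (by linarith [hptK.1]) (by nlinarith [hptK.1, hptK.2.2.1]) hball.1.le hball.2.le
      (hεf pt).le (hη1 pt) (hη2 pt) hgi'
  have hcard : (Nat.card {i : Fin N // ∃ a h : ℝ,
      (191 / 200 ≤ a ∧ a ≤ 197 / 200 ∧ 81 / 100 * a ≤ h ∧ h ≤ 329 / 400 * a) ∧ Good a h Rs εs N i} : ℝ)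
      ≤ ∑ pt ∈ T, (Nat.card {i : Fin N // Good pt.1 pt.2 (Rf pt) (εf pt) N i} : ℝ) := by
    have h1 := (Finset.card_le_card hsub).trans Finset.card_biUnion_le
    simp only [Nat.card_eq_fintype_card, Fintype.card_subtype]
    exact_mod_cast h1
  have hlt : ∑ pt ∈ T, (Nat.card {i : Fin N // Good pt.1 pt.2 (Rf pt) (εf pt) N i} : ℝ) <
      ∑ pt ∈ T, ρ / T.card * N := Finset.sum_lt_sum_of_nonempty hTne fun pt hpt => hN2 pt hpt
  have hsum : ∑ pt ∈ T, ρ / T.card * (N : ℝ) = ρ * N := by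
    rw [Finset.sum_const, nsmul_eq_mul]
    have : (T.card : ℝ) ≠ 0 := by exact_mod_cast hTne.card_pos.ne'
    field_simp
  have hN1' : ρ * (N : ℝ) ≤ (Nat.card {i : Fin N // ∃ a h : ℝ,
      (191 / 200 ≤ a ∧ a ≤ 197 / 200 ∧ 81 / 100 * a ≤ h ∧ h ≤ 329 / 400 * a) ∧ Good a h Rs εs N i} : ℝ) :=
    hN1
  linarith

end Summit.AtomisticToContinuum.Crystallization.Theorems.GscHingeGlue

end
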